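import Literature.NumberTheory.GaloisCohomology.Howard2004.CasselsTateTowerPairingOneKernelProofs
import HarnessLib

/-!
# Howard 2004, Prop. 1.4.1 in tower currency, `ℤ/p`-valued read: ONE kernel suffices — the RIGHT kernel of a
# bi-additive `Q : H¹_{𝓕(n)}(K, T^{(t)}) × H¹_{𝓕(n)}(K, T^{(0)}) → ℤ/p` follows from its LEFT kernel (proofs file)

Topic `NumberTheory/GaloisCohomology/Howard2004`. THEOREMS ONLY: no definition, no named fact, no instance, no notation,
no `sorry`.  Cell `pub/bsd-print-x9` (seat x10b-p1-w8 g12, brick «C451-ONE-KERNEL-ZMOD», `--supports stmt-BirchSwinnertonDyer-22642`;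
print leaf G87 ↦ the «Flach leaf» C45.1′ `prop141_casselsTate_skewPairing_atLevel` / C45.1″ `…_printIntended`).  Companion of
`CasselsTateTowerPairingOneKernelProofs` (the `R/𝔪`-valued, `R`-equivariant form) for the `ℤ/p`-VALUED tower entry of
x10b-p1-w7 g12 (`CasselsTateSkewPairingOfTowerZModPairingProofs`: a bi-additive `Q : 𝓗_t(n) × 𝓗_0(n) → ℤ/p` on the ENGINE's
modules `S.selmerModuleAt`, kernels `LinearMap.range (S.redSelLE …)`) — the currency in which a port of Prop. 1.4.1 through the
`ℤ/p`-valued local Tate pairings `inv_v(· ∪ ·)` (`localTatePairingZMod`, cf. `TowerSelmerLiftGlobalDualityProofs`) arrives.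

SOURCE. B. Howard, *The Heegner point Kolyvagin system*, Compositio Math. **140** (2004) = arXiv:1202.6340, Prop. 1.4.1 (p0008
L83–98: «… whose kernels on the left and right are the images of `H¹_𝓕(K, T/𝔪^{s+t}T) → H¹_𝓕(K, T/𝔪^sT)`,
`H¹_{𝓕*}(K, T*[𝔪^{s+t}]) →^{π^s} H¹_{𝓕*}(K, T*[𝔪^t])`») and the proof of Thm. 1.4.2 (p0008 L108–L126, «nondegenerate pairing of
`R/𝔪`-vector spaces `V_s × W_s`»: `dim V_s = dim W_s`).

WHAT IS PROVED (FULL `DVRSetting` with H.0–H.5, `k`, `n ∈ 𝓝^{(k)}`, `t + 1 < e_k`; `𝓗_j(n) = S.selmerModuleAt hy j n`).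
* §0 (pure algebra over `ℤ/ℓ`; Mathlib only) `card_mul_card_rightKer_le_zmod`, `forall_apply_eq_zero_iff_mem_of_leftKer_of_card_zmod`
  — the `ℤ/ℓ`-valued twins of `CasselsTateTowerPairingOneKernelProofs` §0 for a bi-additive `Q : A →+ B →+ ℤ/ℓ`, `B` a finite
  `ℤ/ℓ`-space (additive maps `B → ℤ/ℓ` are linear, `AddMonoidHom.toZModLinearMap`): `#A · #rightker ≤ #leftker · #B`, and
  «left kernel `= A'`, `B'` pairs to zero, `#A · #B' = #A' · #B` ⟹ right kernel `= B'`».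
* §1 `natCard_selmerModuleAt_eq`, `natCard_range_redSelLE_eq` — the ENGINE's modules and the ranges of `redSelLE` have the
  cardinalities of the Selmer groups `H¹_{𝓕(n)}(K, T^{(j)})` and of their images under `H¹(red)` (same carriers).
* §2 **`towerZModPairing_hright_of_hleft`** — for ANY bi-additive `Q : 𝓗_t(n) →+ 𝓗_0(n) →+ ZMod p` whose LEFT kernel is
  `range (redSelLE : 𝓗_{t+1}(n) → 𝓗_t(n))` and with `range (redSelLE : 𝓗_{t+1}(n) → 𝓗_0(n))` pairing to zero, the RIGHT kernel
  IS that range — no `R`-balance needed (`𝓗_0(n)` is killed by `p ∈ 𝔪`; the count `#𝓗_t · #red^{t+1}𝓗_{t+1} = #red 𝓗_{t+1} · #𝓗_0`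
  is `CasselsTateTowerPairingOneKernelProofs` §1).

READING.  With x10b-p1-w7 g12's `skewPairings_display_of_towerZModPairing` this makes the RIGHT-kernel computation of a
`ℤ/p`-valued port unnecessary as well: LEFT kernel + «`red^{t+1}` pairs to zero» + `R`-balance + skew ⟹ the leaf at `(k, n, t)`.
Nothing of the pairing is constructed here.

HONEST FRAMING: `Q` is a HYPOTHESIS; Prop. 1.4.1, Thm. 1.4.2, C45.1′/C45.1″ and `thm161_dvrKolyvaginBound` are NOT proved; no summit
statement is proved; the Birch–Swinnerton-Dyer conjecture is not proved by any of this.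
-/

set_option autoImplicit false

noncomputable section

namespace Literature.NumberTheory.GaloisCohomology.Howard2004

open Function NumberField IsDedekindDomain Field
open scoped NumberField ContRepresentation
open Literature.NumberTheory.GaloisRepresentations
open Literature.NumberTheory.GaloisRepresentations.DiscreteGaloisModule

/-! ## §0 Linear algebra over `ℤ/ℓ`: one kernel of a finite bi-additive pairing determines the other -/

section OneKernelZMod

variable {ℓ : ℕ} [Fact ℓ.Prime] {B : Type*} [AddCommGroup B] [Module (ZMod ℓ) B] [Finite B]
  {A : Type*} [AddCommGroup A] [Finite A]

omit [Finite A] in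
/-- **One kernel bounds the other, `ℤ/ℓ`-valued.**  For an additive group `A`, a finite `ℤ/ℓ`-vector space `B` and a
bi-additive `Q : A →+ B →+ ℤ/ℓ`: `#A · #{w | ∀ a, Q a w = 0} ≤ #{a | Q a = 0} · #B` (the linear forms `Q a` lie in the dual
annihilator of the right kernel). [folklore]
[cite: Howard2004HeegnerKolyvagin, proof of Thm. 1.4.2 (arXiv:1202.6340 p0008 L120–L126: «nondegenerate pairing of R/𝔪-vector spaces V_s × W_s»)] -/
theorem card_mul_card_rightKer_le_zmod (Q : A →+ B →+ ZMod ℓ) :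
    Nat.card A * Nat.card ↥(⨅ a, LinearMap.ker ((Q a).toZModLinearMap ℓ) : Submodule (ZMod ℓ) B) ≤
      Nat.card ↥Q.ker * Nat.card B := by
  classical
  haveI : Module.Finite (ZMod ℓ) B := Module.Finite.of_finite
  haveI : Module.Finite (ZMod ℓ) (Module.Dual (ZMod ℓ) B) := inferInstance
  haveI : Finite (Module.Dual (ZMod ℓ) B) := Module.finite_of_finite (ZMod ℓ)
  set W : Submodule (ZMod ℓ) B := ⨅ a, LinearMap.ker ((Q a).toZModLinearMap ℓ) with hW
  have hrange : ∀ φ : ↥Q.range, (φ : B →+ ZMod ℓ).toZModLinearMap ℓ ∈ W.dualAnnihilator := by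
    rintro ⟨φ, a, rfl⟩
    rw [Submodule.mem_dualAnnihilator]
    intro w hw
    rw [hW, Submodule.mem_iInf] at hw
    exact hw a
  have hinj : Function.Injective
      (fun φ : ↥Q.range => (⟨(φ : B →+ ZMod ℓ).toZModLinearMap ℓ, hrange φ⟩ : ↥W.dualAnnihilator)) := by
    intro φ ψ h
    have h' := congrArg (fun z : ↥W.dualAnnihilator => (z : Module.Dual (ZMod ℓ) B)) h
    exact Subtype.ext (AddMonoidHom.toZModLinearMap_injective ℓ h')
  haveI : Module.Finite (ZMod ℓ) ↥W := Module.Finite.of_finite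
  haveI : Module.Finite (ZMod ℓ) ↥W.dualAnnihilator := Module.Finite.of_finite
  have h1 : Nat.card ↥Q.range ≤ Nat.card ↥W.dualAnnihilator := Nat.card_le_card_of_injective _ hinj
  have h2 : Nat.card A = Nat.card ↥Q.ker * Nat.card ↥Q.range := by
    rw [mul_comm, ← Nat.card_congr (QuotientAddGroup.quotientKerEquivRange Q).toEquiv]
    exact AddSubgroup.card_eq_card_quotient_mul_card_addSubgroup Q.ker
  have h3 : Nat.card ↥W.dualAnnihilator * Nat.card ↥W = Nat.card B := by
    rw [Module.natCard_eq_pow_finrank (K := ZMod ℓ) (V := ↥W.dualAnnihilator),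
      Module.natCard_eq_pow_finrank (K := ZMod ℓ) (V := ↥W), Module.natCard_eq_pow_finrank (K := ZMod ℓ) (V := B),
      ← pow_add, add_comm, Subspace.finrank_add_finrank_dualAnnihilator_eq W]
  calc Nat.card A * Nat.card ↥W
      = Nat.card ↥Q.ker * (Nat.card ↥Q.range * Nat.card ↥W) := by rw [h2, mul_assoc]
    _ ≤ Nat.card ↥Q.ker * (Nat.card ↥W.dualAnnihilator * Nat.card ↥W) :=
        Nat.mul_le_mul_left _ (Nat.mul_le_mul_right _ h1)
    _ = Nat.card ↥Q.ker * Nat.card B := by rw [h3]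

/-- **One kernel determines the other, `ℤ/ℓ`-valued.**  If the LEFT kernel `{a | ∀ w, Q a w = 0}` of a bi-additive
`Q : A →+ B →+ ℤ/ℓ` (`A` finite, `B` a finite `ℤ/ℓ`-space) is a subgroup `A'`, a subgroup `B'` pairs to zero with everything and
`#A · #B' = #A' · #B`, then the RIGHT kernel `{w | ∀ a, Q a w = 0}` IS `B'`. [folklore]
[cite: Howard2004HeegnerKolyvagin, proof of Thm. 1.4.2 (arXiv:1202.6340 p0008 L120–L126)] -/
theorem forall_apply_eq_zero_iff_mem_of_leftKer_of_card_zmod (Q : A →+ B →+ ZMod ℓ) (A' : AddSubgroup A)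
    (B' : AddSubgroup B) (hleft : ∀ a, (∀ w, Q a w = 0) ↔ a ∈ A') (hB' : ∀ w ∈ B', ∀ a, Q a w = 0)
    (hcount : Nat.card A * Nat.card ↥B' = Nat.card ↥A' * Nat.card B) :
    ∀ w, (∀ a, Q a w = 0) ↔ w ∈ B' := by
  classical
  set W : Submodule (ZMod ℓ) B := ⨅ a, LinearMap.ker ((Q a).toZModLinearMap ℓ) with hW
  have hmemW : ∀ w, w ∈ W ↔ ∀ a, Q a w = 0 := fun w => by
    rw [hW, Submodule.mem_iInf]
    exact forall_congr' fun a => LinearMap.mem_ker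
  have hker : Q.ker = A' := by
    ext a
    rw [AddMonoidHom.mem_ker, ← hleft a]
    constructor
    · intro h w
      rw [h, AddMonoidHom.zero_apply]
    · intro h
      exact AddMonoidHom.ext fun w => by rw [h w, AddMonoidHom.zero_apply]
  have hle := card_mul_card_rightKer_le_zmod Q
  rw [hker, ← hcount] at hle
  have hApos : 0 < Nat.card A := Nat.card_pos
  have hWle : Nat.card ↥W ≤ Nat.card ↥B' := Nat.le_of_mul_le_mul_left hle hApos
  have hsub : (B' : Set B) ⊆ (W : Set B) := fun w hw => (hmemW w).2 (hB' w hw)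
  have hWle' : (W : Set B).ncard ≤ (B' : Set B).ncard := by
    rw [← Nat.card_coe_set_eq, ← Nat.card_coe_set_eq]
    exact hWle
  have heq : (B' : Set B) = (W : Set B) := Set.eq_of_subset_of_ncard_le hsub hWle' (Set.toFinite _)
  intro w
  rw [← hmemW, ← SetLike.mem_coe, ← heq, SetLike.mem_coe]

end OneKernelZMod

namespace DVRSetting

variable {p : ℕ} [Fact p.Prime] {K : Type} [Field K] [NumberField K]
  {R : Type} [CommRing R] [IsDomain R] [IsDiscreteValuationRing R] [Algebra ℤ_[p] R]
  {N : ℕ → Type} [∀ k, AddCommGroup (N k)] [∀ k, TopologicalSpace (N k)]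
  [∀ k, DiscreteTopology (N k)] [∀ k, Module R (N k)]
  {Rk : ℕ → Type} [∀ k, CommRing (Rk k)] [∀ k, IsLocalRing (Rk k)] [∀ k, TopologicalSpace (Rk k)]
  [∀ k, DiscreteTopology (Rk k)] [∀ k, Algebra ℤ_[p] (Rk k)] [∀ k, Algebra R (Rk k)]
  [∀ k, Module (Rk k) (N k)] [∀ k, IsScalarTower R (Rk k) (N k)]
  {Nbar : Type} [AddCommGroup Nbar] [TopologicalSpace Nbar] [DiscreteTopology Nbar]
  [∀ k, Module (Rk k) Nbar]
  {Nq : ℕ → Finset (HeightOneSpectrum (𝓞 K)) → Type} [∀ k n, AddCommGroup (Nq k n)]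
  [∀ k n, TopologicalSpace (Nq k n)] [∀ k n, DiscreteTopology (Nq k n)]
  [∀ k n, Module (Rk k) (Nq k n)] [∀ k n, Module R (Nq k n)]
  [∀ k n, IsScalarTower R (Rk k) (Nq k n)]

/-! ## §1 Cardinality transfers between the ENGINE's modules and the Selmer groups -/

/-- `#(S.selmerModuleAt hy j n) = #H¹_{𝓕(n)}(K, T^{(j)})` (same carrier). [cite: Howard2004HeegnerKolyvagin, Def. 1.2.2 and Lemma 1.6.4 (arXiv:1202.6340 p. 6 L101–125, p. 11 L88–90)] -/
theorem natCard_selmerModuleAt_eq (S : DVRSetting p K R N Rk Nbar Nq) (hy : S.SatisfiesH) (j : ℕ)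
    (n : Finset (HeightOneSpectrum (𝓞 K))) :
    Nat.card ↥(S.selmerModuleAt hy j n) = Nat.card ↥(((S.t j).atLevel S.jbar n).cond).selmerGroup :=
  Nat.card_congr (Equiv.subtypeEquivRight fun x => S.mem_selmerModuleAt_iff hy j n x)

/-- `#range(redSelLE : 𝓗_j(n) → 𝓗_i(n)) = #H¹(red)(H¹_{𝓕(n)}(K, T^{(j)}))` (same carrier: `redSelLE` is `H¹(red)` on classes).
[cite: Howard2004HeegnerKolyvagin, Lemma 1.6.4 (arXiv:1202.6340 p. 11 L85 – p. 12 L9)] -/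
theorem natCard_range_redSelLE_eq (S : DVRSetting p K R N Rk Nbar Nq) (hy : S.SatisfiesH) {i j : ℕ} (h : i ≤ j)
    (n : Finset (HeightOneSpectrum (𝓞 K))) :
    letI := galoisCohomology.moduleH1 (S.T.ρ j) (S.T.hlin j)
    letI := galoisCohomology.moduleH1 (S.T.ρ i) (S.T.hlin i)
    Nat.card ↥(LinearMap.range (S.redSelLE hy h n)) =
      Nat.card ↥((((S.t j).atLevel S.jbar n).cond).selmerGroup.map (S.redLEH1 h)) := by
  letI := galoisCohomology.moduleH1 (S.T.ρ j) (S.T.hlin j)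
  letI := galoisCohomology.moduleH1 (S.T.ρ i) (S.T.hlin i)
  refine Nat.card_congr (Equiv.ofBijective
    (fun w => (⟨((w.1 : ↥(S.selmerModuleAt hy i n)) : galoisCohomology (S.T.ρ i) 1), by
      obtain ⟨z, hz⟩ := w.2
      refine ⟨(z : galoisCohomology (S.T.ρ j) 1), (S.mem_selmerModuleAt_iff hy j n _).1 z.2, ?_⟩
      rw [← hz]
      exact (S.coe_redSelLE_apply hy h n z).symm⟩ :
        ↥((((S.t j).atLevel S.jbar n).cond).selmerGroup.map (S.redLEH1 h)))) ⟨?_, ?_⟩)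
  · intro w w' hww'
    have h1 := congrArg Subtype.val hww'
    exact Subtype.ext (Subtype.ext h1)
  · rintro ⟨y, z, hz, rfl⟩
    refine ⟨⟨⟨S.redLEH1 h z, S.redLEH1_mem_selmerGroup_atLevel hy h n hz⟩,
      ⟨⟨z, (S.mem_selmerModuleAt_iff hy j n z).2 hz⟩, Subtype.ext (S.coe_redSelLE_apply hy h n _)⟩⟩, rfl⟩

/-! ## §2 The RIGHT kernel of a `ℤ/p`-valued tower pairing from its LEFT kernel -/

/-- **ONE KERNEL SUFFICES, `ℤ/p`-valued read (Prop. 1.4.1 in tower currency).**  On a FULL `DVRSetting` with H.0–H.5, fix `k`,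
`n ∈ 𝓝^{(k)}`, `t + 1 < e_k`, and let `Q : 𝓗_t(n) →+ 𝓗_0(n) →+ ZMod p` be ANY bi-additive pairing on the engine's modules
`𝓗_j(n) = H¹_{𝓕(n)}(K, T^{(j)})` whose LEFT kernel is exactly `range (redSelLE : 𝓗_{t+1}(n) → 𝓗_t(n))` and such that
`range (redSelLE : 𝓗_{t+1}(n) → 𝓗_0(n))` pairs to zero.  THEN the RIGHT kernel is exactly that range («on the right the image of
`π^s`», the `T*`-side read on the `T`-side) — by the count «`dim V_s = dim W_s`» (`CasselsTateTowerPairingOneKernelProofs` §1)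
and §0 over `ℤ/p` (`𝓗_0(n)` is killed by `p ∈ 𝔪`; no `R`-balance is needed).
[cite: Howard2004HeegnerKolyvagin, Prop. 1.4.1 and the proof of Thm. 1.4.2 (arXiv:1202.6340 p0008 L83–L126), Lemma 1.3.3 (p. 7 L152–160)]
[cite: Flach1990, the generalised Cassels–Tate pairing and its kernels] -/
theorem towerZModPairing_hright_of_hleft (S : DVRSetting p K R N Rk Nbar Nq) (hy : S.SatisfiesH)
    (hfull : ∀ i, S.e i = i + 1) (k : ℕ) (n : Finset (HeightOneSpectrum (𝓞 K)))
    (hn : ↑n ⊆ S.levelPrimes k) (t : ℕ) (ht : t + 1 < S.e k)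
    (Q : ↥(S.selmerModuleAt hy t n) →+ ↥(S.selmerModuleAt hy 0 n) →+ ZMod p)
    (hleft : letI := galoisCohomology.moduleH1 (S.T.ρ t) (S.T.hlin t)
      letI := galoisCohomology.moduleH1 (S.T.ρ (t + 1)) (S.T.hlin (t + 1))
      ∀ a : ↥(S.selmerModuleAt hy t n), (∀ w, Q a w = 0) ↔
        a ∈ LinearMap.range (S.redSelLE hy (Nat.le_succ t) n))
    (hright_le : letI := galoisCohomology.moduleH1 (S.T.ρ 0) (S.T.hlin 0)
      letI := galoisCohomology.moduleH1 (S.T.ρ (t + 1)) (S.T.hlin (t + 1))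
      ∀ (z : ↥(S.selmerModuleAt hy (t + 1) n)) (a : ↥(S.selmerModuleAt hy t n)),
        Q a (S.redSelLE hy (Nat.zero_le (t + 1)) n z) = 0) :
    letI := galoisCohomology.moduleH1 (S.T.ρ 0) (S.T.hlin 0)
    letI := galoisCohomology.moduleH1 (S.T.ρ (t + 1)) (S.T.hlin (t + 1))
    ∀ w : ↥(S.selmerModuleAt hy 0 n), (∀ a, Q a w = 0) ↔
      w ∈ LinearMap.range (S.redSelLE hy (Nat.zero_le (t + 1)) n) := by
  classical
  letI mod0 : Module R (galoisCohomology (S.T.ρ 0) 1) := galoisCohomology.moduleH1 (S.T.ρ 0) (S.T.hlin 0)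
  letI modt : Module R (galoisCohomology (S.T.ρ t) 1) := galoisCohomology.moduleH1 (S.T.ρ t) (S.T.hlin t)
  letI mods : Module R (galoisCohomology (S.T.ρ (t + 1)) 1) :=
    galoisCohomology.moduleH1 (S.T.ρ (t + 1)) (S.T.hlin (t + 1))
  have htk : t + 1 ≤ k := by rw [hfull k] at ht; omega
  -- finiteness
  haveI : Finite ↥(((S.t t).atLevel S.jbar n).cond).selmerGroup := S.finite_selmerGroup_modify hy t ∅ ∅ n
  haveI : Finite ↥(((S.t 0).atLevel S.jbar n).cond).selmerGroup := S.finite_selmerGroup_modify hy 0 ∅ ∅ n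
  haveI : Finite ↥(((S.t (t + 1)).atLevel S.jbar n).cond).selmerGroup := S.finite_selmerGroup_modify hy (t + 1) ∅ ∅ n
  haveI : Finite ↥(S.selmerModuleAt hy t n) :=
    Finite.of_equiv _ (Equiv.subtypeEquivRight fun x => (S.mem_selmerModuleAt_iff hy t n x).symm)
  -- the residual Selmer group `B₀ = H¹_{𝓕(n)}(K, T̄)` as a `ℤ/p`-vector space: `p ∈ 𝔪 = (π)` and `π` kills `H¹(K, T̄)`
  have hkill0 : ∀ x : galoisCohomology (S.T.ρ 0) 1, S.π • x = 0 := fun x => by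
    have h := S.pow_e_smul_eq_zero hy 0 x
    rwa [hfull 0, zero_add, pow_one] at h
  have hpR : ∀ x : galoisCohomology (S.T.ρ 0) 1, ((p : ℕ) : R) • x = 0 := by
    intro x
    have h1 : ((p : ℕ) : R) ∈ Ideal.span {S.π} := by rw [← hy.unif]; exact S.natCast_p_mem_maximalIdeal hy
    obtain ⟨c, hc⟩ := Ideal.mem_span_singleton'.1 h1
    rw [← hc, mul_smul, hkill0, smul_zero]
  have hp0 : ∀ w : ↥(((S.t 0).atLevel S.jbar n).cond).selmerGroup, p • w = 0 := by
    intro w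
    apply Subtype.ext
    rw [AddSubgroupClass.coe_nsmul, ZeroMemClass.coe_zero, ← Nat.cast_smul_eq_nsmul R, hpR]
  letI modZ : Module (ZMod p) ↥(((S.t 0).atLevel S.jbar n).cond).selmerGroup := AddCommGroup.zmodModule hp0
  -- the identification of carriers `B₀ = S.selmerModuleAt hy 0 n`
  let e : ↥(((S.t 0).atLevel S.jbar n).cond).selmerGroup ≃+ ↥(S.selmerModuleAt hy 0 n) :=
    { toFun := fun w => ⟨w.1, (S.mem_selmerModuleAt_iff hy 0 n w.1).2 w.2⟩
      invFun := fun b => ⟨b.1, (S.mem_selmerModuleAt_iff hy 0 n b.1).1 b.2⟩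
      left_inv := fun w => rfl
      right_inv := fun b => rfl
      map_add' := fun w w' => rfl }
  -- the pairing read on `B₀`
  let Q' : ↥(S.selmerModuleAt hy t n) →+ ↥(((S.t 0).atLevel S.jbar n).cond).selmerGroup →+ ZMod p :=
    Q.compl₂ e.toAddMonoidHom
  have hQ' : ∀ a w, Q' a w = Q a (e w) := fun a w => AddMonoidHom.compl₂_apply Q e.toAddMonoidHom a w
  -- `A' = range red ≤ 𝓗_t`, `B' = red^{t+1}(𝓗_{t+1}) ≤ B₀`, and the count
  let A' : AddSubgroup ↥(S.selmerModuleAt hy t n) := (LinearMap.range (S.redSelLE hy (Nat.le_succ t) n)).toAddSubgroup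
  let B' : AddSubgroup ↥(((S.t 0).atLevel S.jbar n).cond).selmerGroup :=
    ((((S.t (t + 1)).atLevel S.jbar n).cond).selmerGroup.map (S.redLEH1 (Nat.zero_le (t + 1)))).addSubgroupOf
      (((S.t 0).atLevel S.jbar n).cond).selmerGroup
  have hB'le : (((S.t (t + 1)).atLevel S.jbar n).cond).selmerGroup.map (S.redLEH1 (Nat.zero_le (t + 1))) ≤
      (((S.t 0).atLevel S.jbar n).cond).selmerGroup := by
    rintro _ ⟨z, hz, rfl⟩
    exact S.redLEH1_mem_selmerGroup_atLevel hy (Nat.zero_le (t + 1)) n hz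
  have hmemB' : ∀ w : ↥(((S.t 0).atLevel S.jbar n).cond).selmerGroup, w ∈ B' ↔
      ∃ z ∈ (((S.t (t + 1)).atLevel S.jbar n).cond).selmerGroup,
        S.redLEH1 (Nat.zero_le (t + 1)) z = (w : galoisCohomology (S.T.ρ 0) 1) := by
    intro w
    rw [AddSubgroup.mem_addSubgroupOf, AddSubgroup.mem_map]
  have hcount : Nat.card ↥(S.selmerModuleAt hy t n) * Nat.card ↥B' =
      Nat.card ↥A' * Nat.card ↥(((S.t 0).atLevel S.jbar n).cond).selmerGroup := by
    have hA' : Nat.card ↥A' = Nat.card ↥((((S.t (t + 1)).atLevel S.jbar n).cond).selmerGroup.map (S.redLEH1 (Nat.le_succ t))) :=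
      S.natCard_range_redSelLE_eq hy (Nat.le_succ t) n
    have hB' : Nat.card ↥B' =
        Nat.card ↥((((S.t (t + 1)).atLevel S.jbar n).cond).selmerGroup.map (S.redLEH1 (Nat.zero_le (t + 1)))) :=
      Nat.card_congr (AddSubgroup.addSubgroupOfEquivOfLe hB'le).toEquiv
    rw [hA', hB', S.natCard_selmerModuleAt_eq hy t n,
      ← S.card_selmerGroup_atLevel_succ_eq_card_mul_card_map_redLEH1_zero hy hfull k n hn t htk, mul_comm,
      ← S.card_selmerGroup_atLevel_succ_eq_card_zero_mul_card_map_redLEH1 hy hfull k n hn t htk]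
  -- §0 over `ℤ/p`
  have hleftQ' : ∀ a, (∀ w, Q' a w = 0) ↔ a ∈ A' := fun a => by
    rw [Submodule.mem_toAddSubgroup, ← hleft a]
    constructor
    · intro h w
      have h1 := h (e.symm w)
      rwa [hQ', e.apply_symm_apply] at h1
    · intro h w
      rw [hQ']
      exact h _
  have hB'Q' : ∀ w ∈ B', ∀ a, Q' a w = 0 := by
    intro w hw a
    obtain ⟨z, hz, hzw⟩ := (hmemB' w).1 hw
    rw [hQ']
    have h1 : e w = S.redSelLE hy (Nat.zero_le (t + 1)) n ⟨z, (S.mem_selmerModuleAt_iff hy (t + 1) n z).2 hz⟩ :=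
      Subtype.ext (by rw [S.coe_redSelLE_apply]; exact hzw.symm)
    rw [h1]
    exact hright_le _ a
  have main := forall_apply_eq_zero_iff_mem_of_leftKer_of_card_zmod Q' A' B' hleftQ' hB'Q' hcount
  -- read back on `S.selmerModuleAt hy 0 n`
  intro w
  have h1 : (∀ a, Q a w = 0) ↔ ∀ a, Q' a (e.symm w) = 0 := by
    refine forall_congr' fun a => ?_
    rw [hQ', e.apply_symm_apply]
  rw [h1, main (e.symm w), hmemB', LinearMap.mem_range]
  constructor
  · rintro ⟨z, hz, hzw⟩
    exact ⟨⟨z, (S.mem_selmerModuleAt_iff hy (t + 1) n z).2 hz⟩,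
      Subtype.ext (by rw [S.coe_redSelLE_apply]; exact hzw)⟩
  · rintro ⟨z, hzw⟩
    exact ⟨(z : galoisCohomology (S.T.ρ (t + 1)) 1), (S.mem_selmerModuleAt_iff hy (t + 1) n _).1 z.2, by
      rw [← hzw]; rfl⟩

end DVRSetting

end Literature.NumberTheory.GaloisCohomology.Howard2004

end
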